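/-
Copyright (c) 2026 the pub-hodgecm-mathlib formalisation cell (harness21).  Prover seat hodgecm-mathlib-F0P2-p07 (g2): Track B «K2-LIT»,
hLiu418 = stmt-HodgeConjecture-24832; LEAD F0P6-plan (g15) RULING M-160f ∕ BATCH #242 «(σ-A) brick [A1-ζ]» (the ζ-stage half of [A1], split off
K2Liu-p09 (g9)'s ★ `K2LiuLocalSWCornerActionWords`; his `HANDOFF-A1.md` §2 RECIPE 01:48Z); (σ-A) road desk K2Liu-p25 (g3).
-/
import Summits.HodgeConjecture.HodgeConjecture.Theorems.K2LiuBlockImplementerLeviAction       -- ★ (C3-a): the Siegel Levi through an implementer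
import Summits.HodgeConjecture.HodgeConjecture.Theorems.K2LiuLocalSWTensorAdaptedBlocks         -- ★ F5c-A: `tensorEmbLoc` adapted blocks, `isSiegelDelta_tensorEmbLoc`
import Summits.HodgeConjecture.HodgeConjecture.Theorems.K2LiuDoubledUTwoTwoLetterTransport      -- ★ B1b-2d: the transported `w₁`, `u_−(ζ)` are Siegel-Levi, `χ_v(det_Δ)`
import Summits.HodgeConjecture.HodgeConjecture.Theorems.K2LiuSiegelLeviWeylAlgebra              -- ★ `detDelta_levi`, `isUnit_det_blkA_blkD`
import HarnessLib

/-!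
# Crux `HLiu418`, #42S block D row D-2, (σ-A) brick [A1-ζ]: THE ζ-STAGE CORNER WORDS — THE TRANSPORTED LEVI LETTERS `φ(w₁)`, `φ(u_−(ζ))` ACT ON THE
# SCHRÖDINGER MODEL OF THE TENSOR DATUM THROUGH ANY IMPLEMENTER AS `χ_v(det_Δ)^{M₂} · |det B|^{-1/2} · (· ∘ B⁻¹)`

Cell `hodgecm-mathlib`, crux item hLiu418 = `stmt-HodgeConjecture-24832`; squad K2 ∕ K2Liu; prover F0P2-p07 (g2).  THEOREMS ONLY (no `def`, no instance,
no notation, no named-fact hypothesis, no `sorry`); lane `--supports stmt-HodgeConjecture-24832 --as helper` (count-neutral helper).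

WHY.  In ★ p863595 `K2LiuRankOneStagePlaceLetterValues.chainValues_of_placeLetter` (e′) the ζ-stage reads `N₂ s g = L_E(2s)⁻¹ ∫_ζ N₁ s (φ(w₁)·φ(u_−(ζ e_w))·g) dζ`,
`φ X = frameConj Q (toLocalFour X)`; the two ζ-stage corners `φ(w₁)`, `φ(u_−(ζ))` are SIEGEL-LEVI elements of the small doubled group `U(𝕍^𝔻)(L⁺_v)` (★ B1b-2d
`isSiegelDelta_frameConj_weylOne ∕ uMinus`, `χ_v(det_Δ) = ∏_w χ_w(−1) ∕ 1`) and sit to the RIGHT of the y-stage pair, so in the y-stage word of ★ p864240 ([A1] §3,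
K2Liu-p09) they enter the section VECTOR `ω(s′(tensorEmbLoc (m · h))) Φ` of the local Siegel–Weil section on the TENSOR datum `U(𝕍^𝔻 ⊗ V′)`.  Kudla's Levi action
through an implementer is ★ (C3-a) `K2LiuBlockImplementerLeviAction` for ANY `(n, T₀)`: `ω(m · s_v(p) · m⁻¹) = (χ_v⁻¹(det_Δ p))⁻¹ • leviOpPi B` whenever
`π(m) ι(p) π(m)⁻¹ = m(B)`.  THIS FILE docks the two corners into it on the tensor datum (`n := M₂ + M₂`, `T₀ := gramR e′ dV (tensorFrame dW eW dV′)`):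
* §1 THE TENSOR IMAGE OF A SIEGEL ELEMENT `p₀ ∈ P_Δ` of the small group: `blkC (p₀ ⊗ 1) = 0`, **`detDelta_tensorEmbLoc_of_blkC : det_Δ(p₀ ⊗ 1)_w = (det_Δ(p₀)_w)^{M₂}`**,
  **`chiDet_tensorEmbLoc_of_blkC : χ_v(det_Δ(p₀ ⊗ 1)) = χ_v(det_Δ p₀)^{M₂}`** (★ `detDelta_levi`, ★ F5c-A `blk_matA_tensorEmbLoc`, `det_reindex_kronecker`).
* §2 **THE LEVI WORD THROUGH AN IMPLEMENTER ON THE TENSOR DATUM** for a small Siegel element `p₀`: `toRep_conj_tensorEmbLoc_eq_smul_leviOpPi` and its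
  `op(m) ∘ ω_v ∘ op(m)⁻¹` form `toOp_localOmega_tensorEmbLoc_eq_smul_leviOpPi` — ★ (C3-a) at `p := tensorEmbLoc p₀` (`hp` by ★ `isSiegelDelta_tensorEmbLoc`), scalar
  `(χ_v⁻¹(det_Δ p₀)^{M₂})⁻¹` by §1; the implementer's Levi conjugate `hB` stays BY VALUE (its `B` is the consumer's geometric input, as in ★ (C3-a)).
* §3 **THE TWO ζ-STAGE CORNERS** at the K1a frame `(D, Dinv, Q)` of the small datum `(L⁺, L, c̄, imagUnit, T₂ := gramR e dV dW, J₂D := hermD)`: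
  `…_frameConj_weylOne` (scalar `((∏_w χ_w⁻¹(−1))^{M₂})⁻¹`) and `…_frameConj_uMinus` (scalar `1`: **`ω(m · s′(φ(u_−(ζ)) ⊗ 1) · m⁻¹) = leviOpPi B`**), with `hp`
  DISCHARGED, and the `Δ`-blocks `blkA` of the two tensor images (`reindex epsV (W ⊗ₖ 1)`, `reindex epsV ((1 ζ; 0 1) ⊗ₖ 1)`) for whoever computes `B`.
Consumers: [A3] `K2LiuRankOneStageIntegralsAtHalf` (LH4-p07 (g12)) ζ-stage, [A4]+(σ-C) (K2Liu-p25 (g3) ∕ K2Liu-p08 (g6)); y-stage pair + file of record: ★ p864240 (K2Liu-p09).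
HONEST LABEL.  Count-neutral helper: `HC_CM` is proved only modulo the 7 printed citations (2 remaining named inputs: hLiu418 = `stmt-HodgeConjecture-24832`,
h413 = `stmt-HodgeConjecture-24833`) until rung 0 closes; `hWfun`∕`hseam` stay BY VALUE (R2) per M-160f until [A1]–[A4] + (σ-C) land.

## References
* [Kudla1994] S. S. Kudla, *Splitting metaplectic covers of dual reductive pairs*, Israel J. Math. 87 (1994): §3, Thm. 3.1 (the splitting on `P_Δ`: `χ(x(p))`, Levi action).
* [MoeglinVignerasWaldspurger1987] C. Mœglin, M.-F. Vignéras, J.-L. Waldspurger, LNM 1291 (1987): Chap. 2 II.1 (A), II.6 (Levi elements act by `|det|^{1/2}`-twisted pull-back).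
* [HarrisKudlaSweet1996] M. Harris, S. Kudla, W. J. Sweet, J. AMS 9 (1996): §1 (1.11)–(1.12), (1.15)–(1.16).   * [Rangarao1993] R. Ranga Rao, Pacific J. Math. 157 (1993): Thm 4.1, Lemma 5.1.
-/

set_option autoImplicit false
set_option linter.dupNamespace false -- the mandated namespace repeats `HodgeConjecture.HodgeConjecture`

noncomputable section

open scoped Matrix Kronecker
open NumberField IsDedekindDomain MeasureTheory Matrix
open Literature.RepresentationTheory.HeisenbergGroup Literature.RepresentationTheory.HeisenbergGroup.SymplecticMatrix
open Literature.NumberTheory.Automorphic Literature.NumberTheory.Automorphic.UnitaryGroup Literature.NumberTheory.Weil1964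
open Literature.NumberTheory.GaloisRepresentations Literature.NumberTheory.GaloisRepresentations.IsNonarchimedeanLocalField
open Literature.RepresentationTheory.HarrisKudlaSweet1996
open Literature.NumberTheory.GelbartRogawski1991 Literature.NumberTheory.GelbartRogawski1991.GRConstruction
open Literature.NumberTheory.GelbartRogawski1991.AdaptedBlocks
open Literature.NumberTheory.GelbartRogawski1991.UnitaryDualPair
open Literature.NumberTheory.GelbartRogawski1991.UnitaryDualPair.LocalSplitting
open Literature.NumberTheory.K2Lit.SiegelDoubled
open Literature.NumberTheory.K2Lit.LocalSiegelDoubled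
open Summit.HodgeConjecture.HodgeConjecture.Cruxes.HLiu418.K2LiuLocalSWSectionDefs
open Summit.HodgeConjecture.HodgeConjecture.Cruxes.HLiu418.K2LiuLocalSWTensorAdaptedBlocks
open Summit.HodgeConjecture.HodgeConjecture.Cruxes.HLiu418.K2LiuBlockImplementerLeviAction
open Summit.HodgeConjecture.HodgeConjecture.Cruxes.HLiu418.K2LiuSiegelLeviWeylAlgebra
open Summit.HodgeConjecture.HodgeConjecture.Cruxes.HLiu418.K2LiuLocalSiegelIwasawa
open Summit.HodgeConjecture.HodgeConjecture.Cruxes.HLiu418.K2LiuDoubledUTwoTwoBorelFrame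
open Summit.HodgeConjecture.HodgeConjecture.Cruxes.HLiu418.K2LiuDoubledUTwoTwoWeylCocycle
open Summit.HodgeConjecture.HodgeConjecture.Cruxes.HLiu418.K2LiuDoubledUTwoTwoFrameTransport
open Summit.HodgeConjecture.HodgeConjecture.Cruxes.HLiu418.K2LiuDoubledUTwoTwoLetterTransport

namespace Summit.HodgeConjecture.HodgeConjecture.Cruxes.HLiu418.K2LiuLocalSWCornerActionWordsZeta

variable (L : Type) [Field L] [NumberField L] [IsCMField L]
variable {N M : ℕ} (e : Fin N × Fin M ≃ Fin 2)
  (dV : Fin N → L) (hdV : ∀ i, IsCMField.complexConj L (dV i) = dV i)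
  (dW : Fin M → L) (hdW : ∀ i, IsCMField.complexConj L (dW i) = dW i)
variable {M₂ M' : ℕ} (eW : Fin M × Fin M₂ ≃ Fin M') (e' : Fin N × Fin M' ≃ Fin (M₂ + M₂))
  (dV' : Fin M₂ → L) (hdV' : ∀ k, IsCMField.complexConj L (dV' k) = dV' k)
  (v : HeightOneSpectrum (𝓞 (Fp L)))
  [MeasurableSpace (v.adicCompletion (Fp L))] [BorelSpace (v.adicCompletion (Fp L))]
  (μ : Measure (v.adicCompletion (Fp L))) [μ.IsAddHaarMeasure]
  (χ : HeckeCharacter L) (hχ : IsSplittingChar L 1 χ)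

/-! ## §1 The tensor image `p₀ ⊗ 1` of a Siegel element of the small group: `det_Δ` and `χ_v(det_Δ)` are `M₂`-th powers -/

omit [MeasurableSpace (v.adicCompletion (Fp L))] [BorelSpace (v.adicCompletion (Fp L))] in
/-- **`C(p₀ ⊗ 1) = 0`** for `C(p₀) = 0` (★ F5c-A `blk_matA_tensorEmbLoc`: `C ⊗ 1`). [cite: Kudla1994, §3] -/
theorem blkC_matA_tensorEmbLoc_of_blkC (p₀ : UnitaryGroup.localPi L (IsCMField.complexConj L) (2 + 2) (hermD L e dV hdV dW hdW) v)
    (hC : blkC (matA (Fp L) L (IsCMField.complexConj L) v 2 p₀) = 0) :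
    blkC (matA (Fp L) L (IsCMField.complexConj L) v (M₂ + M₂) (tensorEmbLoc L e dV hdV dW hdW eW e' dV' hdV' v p₀)) = 0 := by
  rw [(blk_matA_tensorEmbLoc L e dV hdV dW hdW eW e' dV' hdV' v p₀).2, hC]
  ext i j
  simp [Matrix.reindex_apply]

omit [MeasurableSpace (v.adicCompletion (Fp L))] [BorelSpace (v.adicCompletion (Fp L))] in
/-- **`A(p₀ ⊗ 1) = reindex epsV (A(p₀) ⊗ₖ 1)`** (★ F5c-A, restated pointer for the consumer who computes the implementer's `B`). [cite: Kudla1994, §3] -/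
theorem blkA_matA_tensorEmbLoc (p₀ : UnitaryGroup.localPi L (IsCMField.complexConj L) (2 + 2) (hermD L e dV hdV dW hdW) v) :
    blkA (matA (Fp L) L (IsCMField.complexConj L) v (M₂ + M₂) (tensorEmbLoc L e dV hdV dW hdW eW e' dV' hdV' v p₀)) =
      Matrix.reindex (epsV e eW e') (epsV e eW e')
        (blkA (matA (Fp L) L (IsCMField.complexConj L) v 2 p₀) ⊗ₖ (1 : Matrix (Fin M₂) (Fin M₂) (LocalRing L v))) :=
  (blk_matA_tensorEmbLoc L e dV hdV dW hdW eW e' dV' hdV' v p₀).1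

omit [MeasurableSpace (v.adicCompletion (Fp L))] [BorelSpace (v.adicCompletion (Fp L))] in
/-- **`det_Δ(p₀ ⊗ 1)_w = (det_Δ(p₀)_w)^{M₂}`** at every `w ∣ v`, for a Siegel element `p₀` of the small group (`C = 0 ⇒ det_Δ = det A`, ★ `detDelta_levi`;
`det (reindex epsV (A ⊗ₖ 1)) = (det A)^{M₂}`). [cite: Kudla1994, §3] [cite: HarrisKudlaSweet1996, §1 (1.15)–(1.16)] -/
theorem detDelta_tensorEmbLoc_of_blkC (p₀ : UnitaryGroup.localPi L (IsCMField.complexConj L) (2 + 2) (hermD L e dV hdV dW hdW) v)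
    (hC : blkC (matA (Fp L) L (IsCMField.complexConj L) v 2 p₀) = 0) (w : PlacesOver L v) :
    detDelta (Fp L) L (IsCMField.complexConj L) v (M₂ + M₂) w (tensorEmbLoc L e dV hdV dW hdW eW e' dV' hdV' v p₀) =
      detDelta (Fp L) L (IsCMField.complexConj L) v 2 w p₀ ^ M₂ := by
  rw [detDelta_levi (Fp L) L (IsCMField.complexConj L) v (M₂ + M₂) (blkC_matA_tensorEmbLoc_of_blkC L e dV hdV dW hdW eW e' dV' hdV' v p₀ hC) w,
    detDelta_levi (Fp L) L (IsCMField.complexConj L) v 2 hC w, blkA_matA_tensorEmbLoc, det_reindex_kronecker, Matrix.det_one, one_pow, mul_one,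
    Fintype.card_fin, Pi.pow_apply]

omit [MeasurableSpace (v.adicCompletion (Fp L))] [BorelSpace (v.adicCompletion (Fp L))] in
/-- **`χ_v(det_Δ(p₀ ⊗ 1)) = χ_v(det_Δ p₀)^{M₂}`** for a Siegel element `p₀` of the small group and any family of characters `χ_w : L_wˣ →* ℂˣ`
(`det_Δ p₀` is a unit on `P_Δ`, ★ `isUnit_det_blkA_blkD`). [cite: Kudla1994, §3, Thm. 3.1] [cite: HarrisKudlaSweet1996, §1 (1.15)] -/
theorem chiDet_tensorEmbLoc_of_blkC (p₀ : UnitaryGroup.localPi L (IsCMField.complexConj L) (2 + 2) (hermD L e dV hdV dW hdW) v)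
    (hC : blkC (matA (Fp L) L (IsCMField.complexConj L) v 2 p₀) = 0) (χv : ∀ w : PlacesOver L v, (w.1.adicCompletion L)ˣ →* ℂˣ) :
    LocalSplitting.chiDet (Fp L) L (IsCMField.complexConj L) v (M₂ + M₂) χv (tensorEmbLoc L e dV hdV dW hdW eW e' dV' hdV' v p₀) =
      LocalSplitting.chiDet (Fp L) L (IsCMField.complexConj L) v 2 χv p₀ ^ M₂ := by
  classical
  unfold LocalSplitting.chiDet
  rw [← Finset.prod_pow]
  refine Finset.prod_congr rfl fun w _ => ?_
  have hu : IsUnit (detDelta (Fp L) L (IsCMField.complexConj L) v 2 w p₀) := by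
    rw [detDelta_levi (Fp L) L (IsCMField.complexConj L) v 2 hC w]
    exact (isUnit_det_blkA_blkD (Fp L) L (IsCMField.complexConj L) v 2 hC).1.map
      (Pi.evalRingHom (fun w' : PlacesOver L v => w'.1.adicCompletion L) w)
  have hdet := detDelta_tensorEmbLoc_of_blkC L e dV hdV dW hdW eW e' dV' hdV' v p₀ hC w
  have hu' : IsUnit (detDelta (Fp L) L (IsCMField.complexConj L) v (M₂ + M₂) w (tensorEmbLoc L e dV hdV dW hdW eW e' dV' hdV' v p₀)) := by
    rw [hdet]; exact hu.pow M₂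
  rw [dif_pos hu', dif_pos hu, ← map_pow]
  congr 1
  ext
  rw [Units.val_pow_eq_pow_val, IsUnit.unit_spec, IsUnit.unit_spec, hdet]

/-! ## §2 The Levi word through an implementer on the tensor datum, for a Siegel element of the small group -/

section TensorDatum

variable (hT₀d : IsUnit (gramR L e' dV hdV (tensorFrame L dW eW dV') (tensorFrame_real L dW hdW eW dV' hdV')).det)

/-- **THE LEVI WORD OF `p₀ ⊗ 1` THROUGH ANY IMPLEMENTER** (`ω(m · s′(p₀ ⊗ 1) · m⁻¹)` form).  For the CM local splitting datum `Σ′` of the TENSOR group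
`U(𝕍^𝔻 ⊗ V′)(L⁺_v)` (`n := M₂ + M₂`, `T₀ := gramR e′ dV (tensorFrame dW eW dV′)`), a Siegel element `p₀ ∈ P_Δ` of the small group, any `m ∈ S̃p_ψ` and `B` with
`π(m) ι(p₀ ⊗ 1) π(m)⁻¹ = m(B)` (BY VALUE): `ω(m · s′(p₀ ⊗ 1) · m⁻¹) Φ = (χ_v⁻¹(det_Δ p₀)^{M₂})⁻¹ • leviOpPi B Φ` — ★ (C3-a) at `p := tensorEmbLoc p₀`
(`hp` by ★ `isSiegelDelta_tensorEmbLoc`), scalar by §1. [cite: Kudla1994, Thm 3.1] [cite: MoeglinVignerasWaldspurger1987, Chap. 2 II.1 (A), II.6] [cite: HarrisKudlaSweet1996, §1 (1.15)–(1.16)] -/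
theorem toRep_conj_tensorEmbLoc_eq_smul_leviOpPi (p₀ : UnitaryGroup.localPi L (IsCMField.complexConj L) (2 + 2) (hermD L e dV hdV dW hdW) v)
    (hp₀ : IsSiegelDelta (Fp L) L (IsCMField.complexConj L) (complexConj_imagUnit L) (imagUnit_ne_zero L) (imagUnit_mul_self L) v 2
      (gramR_isSymm L e dV hdV dW hdW) (hermD_eq_map_gramD L e dV hdV dW hdW) p₀)
    (m : LocalMp (Fp L) ((M₂ + M₂) + (M₂ + M₂))
      (gramD (Fp L) (M₂ + M₂) (gramR L e' dV hdV (tensorFrame L dW eW dV') (tensorFrame_real L dW hdW eW dV' hdV'))) v)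
    (B : GL (Fin ((M₂ + M₂) + (M₂ + M₂))) (v.adicCompletion (Fp L)))
    (hB : MpPsi.proj _ m * iotaD (Fp L) L (IsCMField.complexConj L) (complexConj_imagUnit L) (imagUnit_ne_zero L) (imagUnit_mul_self L) v (M₂ + M₂)
          (gramR_isSymm L e' dV hdV (tensorFrame L dW eW dV') (tensorFrame_real L dW hdW eW dV' hdV'))
          (hermD_eq_map_gramD L e' dV hdV (tensorFrame L dW eW dV') (tensorFrame_real L dW hdW eW dV' hdV'))
          (tensorEmbLoc L e dV hdV dW hdW eW e' dV' hdV' v p₀) * (MpPsi.proj _ m)⁻¹ =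
      transportSp (localGram (Fp L) ((M₂ + M₂) + (M₂ + M₂))
          (gramD (Fp L) (M₂ + M₂) (gramR L e' dV hdV (tensorFrame L dW eW dV') (tensorFrame_real L dW hdW eW dV' hdV'))) v)
        (isUnit_det_localGram_gramD (Fp L) v (M₂ + M₂) hT₀d) (levi B))
    (Φ : SchwartzBruhat (Fin ((M₂ + M₂) + (M₂ + M₂)) → v.adicCompletion (Fp L))) :
    MpPsi.toRep (localSchrodinger (Fp L) ((M₂ + M₂) + (M₂ + M₂))
          (gramD (Fp L) (M₂ + M₂) (gramR L e' dV hdV (tensorFrame L dW eW dV') (tensorFrame_real L dW hdW eW dV' hdV'))) v)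
        (m * (localSplittingDatumCM L v μ (M₂ + M₂)
          (gramR_isSymm L e' dV hdV (tensorFrame L dW eW dV') (tensorFrame_real L dW hdW eW dV' hdV')) hT₀d
          (hermD_eq_map_gramD L e' dV hdV (tensorFrame L dW eW dV') (tensorFrame_real L dW hdW eW dV' hdV')) χ hχ).localSplitting
          (tensorEmbLoc L e dV hdV dW hdW eW e' dV' hdV' v p₀) * m⁻¹) Φ =
      ((LocalSplitting.chiDet (Fp L) L (IsCMField.complexConj L) v 2 (fun w' : PlacesOver L v => (χ.localComponent w'.1)⁻¹) p₀ ^ M₂)⁻¹ : ℂˣ) •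
        leviOpPi (glEquiv B) Φ := by
  haveI : Algebra.IsQuadraticExtension (Fp L) L := IsCMField.isQuadraticExtension L
  rw [toRep_conj_localSplittingDatumCM_eq_smul_leviOpPi_toOp L v μ (M₂ + M₂)
      (gramR_isSymm L e' dV hdV (tensorFrame L dW eW dV') (tensorFrame_real L dW hdW eW dV' hdV')) hT₀d
      (hermD_eq_map_gramD L e' dV hdV (tensorFrame L dW eW dV') (tensorFrame_real L dW hdW eW dV' hdV')) χ hχ m _
      (isSiegelDelta_tensorEmbLoc L e dV hdV dW hdW eW e' dV' hdV' v hp₀) B hB Φ,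
    chiDet_tensorEmbLoc_of_blkC L e dV hdV dW hdW eW e' dV' hdV' v p₀
      ((isSiegelDelta_iff_blkC_eq_zero (Fp L) L (IsCMField.complexConj L) (complexConj_imagUnit L) (imagUnit_ne_zero L) (imagUnit_mul_self L) v 2
        (gramR_isSymm L e dV hdV dW hdW) (hermD_eq_map_gramD L e dV hdV dW hdW) p₀).1 hp₀)]

/-- **… in the consumer's shape `op(m) (ω_{Σ′}(p₀ ⊗ 1) (op(m)⁻¹ Ψ)) = (χ_v⁻¹(det_Δ p₀)^{M₂})⁻¹ • leviOpPi B Ψ`** (★ (C3-a) `toOp_localOmega_toOp_symm_eq_smul_leviOpPi`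
at `p := p₀ ⊗ 1`). [cite: Kudla1994, Thm 3.1] [cite: MoeglinVignerasWaldspurger1987, Chap. 2 II.1 (A), II.6] -/
theorem toOp_localOmega_tensorEmbLoc_eq_smul_leviOpPi (p₀ : UnitaryGroup.localPi L (IsCMField.complexConj L) (2 + 2) (hermD L e dV hdV dW hdW) v)
    (hp₀ : IsSiegelDelta (Fp L) L (IsCMField.complexConj L) (complexConj_imagUnit L) (imagUnit_ne_zero L) (imagUnit_mul_self L) v 2
      (gramR_isSymm L e dV hdV dW hdW) (hermD_eq_map_gramD L e dV hdV dW hdW) p₀)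
    (m : LocalMp (Fp L) ((M₂ + M₂) + (M₂ + M₂))
      (gramD (Fp L) (M₂ + M₂) (gramR L e' dV hdV (tensorFrame L dW eW dV') (tensorFrame_real L dW hdW eW dV' hdV'))) v)
    (B : GL (Fin ((M₂ + M₂) + (M₂ + M₂))) (v.adicCompletion (Fp L)))
    (hB : MpPsi.proj _ m * iotaD (Fp L) L (IsCMField.complexConj L) (complexConj_imagUnit L) (imagUnit_ne_zero L) (imagUnit_mul_self L) v (M₂ + M₂)
          (gramR_isSymm L e' dV hdV (tensorFrame L dW eW dV') (tensorFrame_real L dW hdW eW dV' hdV'))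
          (hermD_eq_map_gramD L e' dV hdV (tensorFrame L dW eW dV') (tensorFrame_real L dW hdW eW dV' hdV'))
          (tensorEmbLoc L e dV hdV dW hdW eW e' dV' hdV' v p₀) * (MpPsi.proj _ m)⁻¹ =
      transportSp (localGram (Fp L) ((M₂ + M₂) + (M₂ + M₂))
          (gramD (Fp L) (M₂ + M₂) (gramR L e' dV hdV (tensorFrame L dW eW dV') (tensorFrame_real L dW hdW eW dV' hdV'))) v)
        (isUnit_det_localGram_gramD (Fp L) v (M₂ + M₂) hT₀d) (levi B))
    (Ψ : SchwartzBruhat (Fin ((M₂ + M₂) + (M₂ + M₂)) → v.adicCompletion (Fp L))) :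
    MpPsi.toOp _ m
        ((localSplittingDatumCM L v μ (M₂ + M₂)
          (gramR_isSymm L e' dV hdV (tensorFrame L dW eW dV') (tensorFrame_real L dW hdW eW dV' hdV')) hT₀d
          (hermD_eq_map_gramD L e' dV hdV (tensorFrame L dW eW dV') (tensorFrame_real L dW hdW eW dV' hdV')) χ hχ).localOmega
          (tensorEmbLoc L e dV hdV dW hdW eW e' dV' hdV' v p₀) ((MpPsi.toOp _ m).symm Ψ)) =
      ((LocalSplitting.chiDet (Fp L) L (IsCMField.complexConj L) v 2 (fun w' : PlacesOver L v => (χ.localComponent w'.1)⁻¹) p₀ ^ M₂)⁻¹ : ℂˣ) •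
        leviOpPi (glEquiv B) Ψ := by
  haveI : Algebra.IsQuadraticExtension (Fp L) L := IsCMField.isQuadraticExtension L
  rw [toOp_localOmega_toOp_symm_eq_smul_leviOpPi L v μ (M₂ + M₂)
      (gramR_isSymm L e' dV hdV (tensorFrame L dW eW dV') (tensorFrame_real L dW hdW eW dV' hdV')) hT₀d
      (hermD_eq_map_gramD L e' dV hdV (tensorFrame L dW eW dV') (tensorFrame_real L dW hdW eW dV' hdV')) χ hχ m _
      (isSiegelDelta_tensorEmbLoc L e dV hdV dW hdW eW e' dV' hdV' v hp₀) B hB Ψ,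
    chiDet_tensorEmbLoc_of_blkC L e dV hdV dW hdW eW e' dV' hdV' v p₀
      ((isSiegelDelta_iff_blkC_eq_zero (Fp L) L (IsCMField.complexConj L) (complexConj_imagUnit L) (imagUnit_ne_zero L) (imagUnit_mul_self L) v 2
        (gramR_isSymm L e dV hdV dW hdW) (hermD_eq_map_gramD L e dV hdV dW hdW) p₀).1 hp₀)]

/-! ## §3 The two ζ-stage corners `φ(w₁)`, `φ(u_−(ζ))` at the K1a frame of the small CM datum -/

section Corners

variable (D Dinv : Matrix (Fin 2) (Fin 2) (Fp L)) (hDD : D * Dinv = 1) (Q : GL (Fin (2 + 2)) (Fp L))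
  (hQm : (Q : Matrix (Fin (2 + 2)) (Fin (2 + 2)) (Fp L)) = Matrix.reindex (e₂ 2) (e₂ 2) (Matrix.fromBlocks 1 D 1 (-D)))
  (hQ : (Q : Matrix (Fin (2 + 2)) (Fin (2 + 2)) (Fp L))ᵀ * gramD (Fp L) 2 (gramR L e dV hdV dW hdW) * (Q : Matrix (Fin (2 + 2)) (Fin (2 + 2)) (Fp L)) =
    (StdForm.antidiagonal (2 + 2)).over (Fp L))

include hDD hQm in
/-- **THE `w₁`-CORNER WORD.**  At the K1a frame `(D, Dinv, Q)` of the small CM datum, `φ(w₁) = frameConj Q (toLocalFour w₁)` is Siegel-Levi with `χ_v⁻¹(det_Δ φ(w₁)) =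
∏_w χ_w⁻¹(−1)` (★ B1b-2d); through any implementer `m` of the tensor datum with `π(m) ι(φ(w₁) ⊗ 1) π(m)⁻¹ = m(B)`:
`ω(m · s′(φ(w₁) ⊗ 1) · m⁻¹) Φ = ((∏_w χ_w⁻¹(−1))^{M₂})⁻¹ • leviOpPi B Φ`. [cite: Kudla1994, Thm 3.1] [cite: MoeglinVignerasWaldspurger1987, Chap. 2 II.6] [cite: HarrisKudlaSweet1996, §1 (1.12), (1.15)] -/
theorem toRep_conj_tensorEmbLoc_frameConj_weylOne_eq_smul_leviOpPi
    (m : LocalMp (Fp L) ((M₂ + M₂) + (M₂ + M₂))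
      (gramD (Fp L) (M₂ + M₂) (gramR L e' dV hdV (tensorFrame L dW eW dV') (tensorFrame_real L dW hdW eW dV' hdV'))) v)
    (B : GL (Fin ((M₂ + M₂) + (M₂ + M₂))) (v.adicCompletion (Fp L)))
    (hB : haveI : Algebra.IsQuadraticExtension (Fp L) L := IsCMField.isQuadraticExtension L
      MpPsi.proj _ m * iotaD (Fp L) L (IsCMField.complexConj L) (complexConj_imagUnit L) (imagUnit_ne_zero L) (imagUnit_mul_self L) v (M₂ + M₂)
          (gramR_isSymm L e' dV hdV (tensorFrame L dW eW dV') (tensorFrame_real L dW hdW eW dV' hdV'))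
          (hermD_eq_map_gramD L e' dV hdV (tensorFrame L dW eW dV') (tensorFrame_real L dW hdW eW dV' hdV'))
          (tensorEmbLoc L e dV hdV dW hdW eW e' dV' hdV' v
            (FrameTransport.frameConj (Fp L) L (IsCMField.complexConj L) v (2 + 2) (hermD_eq_map_gramD L e dV hdV dW hdW)
              (antidiagonal_over_eq_map (Fp L) L 2) Q hQ
              (toLocalFour (Fp L) L (IsCMField.complexConj L) v
                (weylOne (UnitaryGroup.LocalRing L v) (UnitaryGroup.conjLocal L (IsCMField.complexConj L) v))))) * (MpPsi.proj _ m)⁻¹ =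
      transportSp (localGram (Fp L) ((M₂ + M₂) + (M₂ + M₂))
          (gramD (Fp L) (M₂ + M₂) (gramR L e' dV hdV (tensorFrame L dW eW dV') (tensorFrame_real L dW hdW eW dV' hdV'))) v)
        (isUnit_det_localGram_gramD (Fp L) v (M₂ + M₂) hT₀d) (levi B))
    (Φ : SchwartzBruhat (Fin ((M₂ + M₂) + (M₂ + M₂)) → v.adicCompletion (Fp L))) :
    haveI : Algebra.IsQuadraticExtension (Fp L) L := IsCMField.isQuadraticExtension L
    MpPsi.toRep (localSchrodinger (Fp L) ((M₂ + M₂) + (M₂ + M₂))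
          (gramD (Fp L) (M₂ + M₂) (gramR L e' dV hdV (tensorFrame L dW eW dV') (tensorFrame_real L dW hdW eW dV' hdV'))) v)
        (m * (localSplittingDatumCM L v μ (M₂ + M₂)
          (gramR_isSymm L e' dV hdV (tensorFrame L dW eW dV') (tensorFrame_real L dW hdW eW dV' hdV')) hT₀d
          (hermD_eq_map_gramD L e' dV hdV (tensorFrame L dW eW dV') (tensorFrame_real L dW hdW eW dV' hdV')) χ hχ).localSplitting
          (tensorEmbLoc L e dV hdV dW hdW eW e' dV' hdV' v
            (FrameTransport.frameConj (Fp L) L (IsCMField.complexConj L) v (2 + 2) (hermD_eq_map_gramD L e dV hdV dW hdW)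
              (antidiagonal_over_eq_map (Fp L) L 2) Q hQ
              (toLocalFour (Fp L) L (IsCMField.complexConj L) v
                (weylOne (UnitaryGroup.LocalRing L v) (UnitaryGroup.conjLocal L (IsCMField.complexConj L) v))))) * m⁻¹) Φ =
      (((∏ w : PlacesOver L v, (χ.localComponent w.1)⁻¹ (-1)) ^ M₂)⁻¹ : ℂˣ) • leviOpPi (glEquiv B) Φ := by
  haveI : Algebra.IsQuadraticExtension (Fp L) L := IsCMField.isQuadraticExtension L
  rw [toRep_conj_tensorEmbLoc_eq_smul_leviOpPi L e dV hdV dW hdW eW e' dV' hdV' v μ χ hχ hT₀d _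
      (isSiegelDelta_frameConj_weylOne (Fp L) L (IsCMField.complexConj L) (complexConj_imagUnit L) (imagUnit_ne_zero L) (imagUnit_mul_self L) v
        (gramR_isSymm L e dV hdV dW hdW) (hermD_eq_map_gramD L e dV hdV dW hdW) D Dinv hDD Q hQm hQ) m B hB Φ,
    chiDet_frameConj_weylOne (Fp L) L (IsCMField.complexConj L) v (hermD_eq_map_gramD L e dV hdV dW hdW) D Dinv hDD Q hQm hQ]

include hDD hQm in
/-- **THE `u_−(ζ)`-CORNER WORD — NO SCALAR.**  `φ(u_−(ζ))` is Siegel-Levi with `χ_v(det_Δ) = 1` (★ B1b-2d), so through any implementer `m` of the tensor datum with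
`π(m) ι(φ(u_−(ζ)) ⊗ 1) π(m)⁻¹ = m(B)`: **`ω(m · s′(φ(u_−(ζ)) ⊗ 1) · m⁻¹) Φ = leviOpPi B Φ`**, for every `ζ ∈ L ⊗ L⁺_v` (the letter `ζ e_w = Pi.single w ζ` of ★ p863595
(e′) included).  SHEAR SLOT (desk K2Liu-p25 (g3) WORD #7): Rao's reading is `(leviOpPi B Ψ)(u) = |det B|^{-1/2} · Ψ(B⁻¹ u)` (★ `coe_leviOpPi_apply`) — the argument is
composed with `B⁻¹`.  The `Δ`-block of `φ(u_−(ζ))` is the UPPER shear `A = (1 ζ; 0 1)` (★ B1b-2d `blocks_matA_frameConj_uMinus`; `A (x₁, x₂) = (x₁ + ζ x₂, x₂)`,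
`A⁻¹ (x₁, x₂) = (x₁ − ζ x₂, x₂)`: the SECOND line shears INTO the first), tensored with `1_{V′}` (`blkA_matA_tensorEmbLoc_frameConj_weylOne_uMinus` below); which
realification of `A ⊗ 1` (or of its `σ`-inverse-transpose `D`-block `(1 −σζ; 0 1)`) the implementer's `B` IS, is exactly the content of `hB` and is fixed by the
consumer's `m` — for an implementer whose projection carries the `Δ`-frame onto `ℓ_Y` coordinatewise, `B` is `reindex epsV (A ⊗ₖ 1)` in `L⁺_v`-coordinates, so
`Ψ(B⁻¹ u)` reads `Ψ` at `(u₁ − ζ u₂, u₂)` linewise (p09's convention governs the sign of `ζ` if his y-stage frame differs).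
[cite: Kudla1994, Thm 3.1] [cite: MoeglinVignerasWaldspurger1987, Chap. 2 II.6] [cite: HarrisKudlaSweet1996, §1 (1.11), (1.15)] [cite: Rangarao1993, Lemma 3.2 (1), (3.8), p. 351] -/
theorem toRep_conj_tensorEmbLoc_frameConj_uMinus_eq_leviOpPi (z : UnitaryGroup.LocalRing L v)
    (m : LocalMp (Fp L) ((M₂ + M₂) + (M₂ + M₂))
      (gramD (Fp L) (M₂ + M₂) (gramR L e' dV hdV (tensorFrame L dW eW dV') (tensorFrame_real L dW hdW eW dV' hdV'))) v)
    (B : GL (Fin ((M₂ + M₂) + (M₂ + M₂))) (v.adicCompletion (Fp L)))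
    (hB : haveI : Algebra.IsQuadraticExtension (Fp L) L := IsCMField.isQuadraticExtension L
      MpPsi.proj _ m * iotaD (Fp L) L (IsCMField.complexConj L) (complexConj_imagUnit L) (imagUnit_ne_zero L) (imagUnit_mul_self L) v (M₂ + M₂)
          (gramR_isSymm L e' dV hdV (tensorFrame L dW eW dV') (tensorFrame_real L dW hdW eW dV' hdV'))
          (hermD_eq_map_gramD L e' dV hdV (tensorFrame L dW eW dV') (tensorFrame_real L dW hdW eW dV' hdV'))
          (tensorEmbLoc L e dV hdV dW hdW eW e' dV' hdV' v
            (FrameTransport.frameConj (Fp L) L (IsCMField.complexConj L) v (2 + 2) (hermD_eq_map_gramD L e dV hdV dW hdW)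
              (antidiagonal_over_eq_map (Fp L) L 2) Q hQ
              (toLocalFour (Fp L) L (IsCMField.complexConj L) v
                (uMinus (UnitaryGroup.LocalRing L v) (UnitaryGroup.conjLocal L (IsCMField.complexConj L) v)
                  (UnitaryGroup.conjLocal_conjLocal (IsCMField.complexConj L) v (complexConj_imagUnit L) (imagUnit_ne_zero L)) z)))) * (MpPsi.proj _ m)⁻¹ =
      transportSp (localGram (Fp L) ((M₂ + M₂) + (M₂ + M₂))
          (gramD (Fp L) (M₂ + M₂) (gramR L e' dV hdV (tensorFrame L dW eW dV') (tensorFrame_real L dW hdW eW dV' hdV'))) v)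
        (isUnit_det_localGram_gramD (Fp L) v (M₂ + M₂) hT₀d) (levi B))
    (Φ : SchwartzBruhat (Fin ((M₂ + M₂) + (M₂ + M₂)) → v.adicCompletion (Fp L))) :
    haveI : Algebra.IsQuadraticExtension (Fp L) L := IsCMField.isQuadraticExtension L
    MpPsi.toRep (localSchrodinger (Fp L) ((M₂ + M₂) + (M₂ + M₂))
          (gramD (Fp L) (M₂ + M₂) (gramR L e' dV hdV (tensorFrame L dW eW dV') (tensorFrame_real L dW hdW eW dV' hdV'))) v)
        (m * (localSplittingDatumCM L v μ (M₂ + M₂)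
          (gramR_isSymm L e' dV hdV (tensorFrame L dW eW dV') (tensorFrame_real L dW hdW eW dV' hdV')) hT₀d
          (hermD_eq_map_gramD L e' dV hdV (tensorFrame L dW eW dV') (tensorFrame_real L dW hdW eW dV' hdV')) χ hχ).localSplitting
          (tensorEmbLoc L e dV hdV dW hdW eW e' dV' hdV' v
            (FrameTransport.frameConj (Fp L) L (IsCMField.complexConj L) v (2 + 2) (hermD_eq_map_gramD L e dV hdV dW hdW)
              (antidiagonal_over_eq_map (Fp L) L 2) Q hQ
              (toLocalFour (Fp L) L (IsCMField.complexConj L) v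
                (uMinus (UnitaryGroup.LocalRing L v) (UnitaryGroup.conjLocal L (IsCMField.complexConj L) v)
                  (UnitaryGroup.conjLocal_conjLocal (IsCMField.complexConj L) v (complexConj_imagUnit L) (imagUnit_ne_zero L)) z)))) * m⁻¹) Φ =
      leviOpPi (glEquiv B) Φ := by
  haveI : Algebra.IsQuadraticExtension (Fp L) L := IsCMField.isQuadraticExtension L
  rw [toRep_conj_tensorEmbLoc_eq_smul_leviOpPi L e dV hdV dW hdW eW e' dV' hdV' v μ χ hχ hT₀d _
      (isSiegelDelta_frameConj_uMinus (Fp L) L (IsCMField.complexConj L) (complexConj_imagUnit L) (imagUnit_ne_zero L) (imagUnit_mul_self L) v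
        (gramR_isSymm L e dV hdV dW hdW) (hermD_eq_map_gramD L e dV hdV dW hdW) D Dinv hDD Q hQm hQ z) m B hB Φ,
    chiDet_frameConj_uMinus (Fp L) L (IsCMField.complexConj L) (complexConj_imagUnit L) (imagUnit_ne_zero L) v (hermD_eq_map_gramD L e dV hdV dW hdW)
      D Dinv hDD Q hQm hQ _ z, one_pow, inv_one, one_smul]

omit [MeasurableSpace (v.adicCompletion (Fp L))] [BorelSpace (v.adicCompletion (Fp L))] in
include hDD hQm in
/-- **the `Δ`-blocks of the two tensor images** (for whoever computes the implementer's `B`): `A(φ(w₁) ⊗ 1) = reindex epsV (W ⊗ₖ 1)`, `W = (0 1; 1 0)`, and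
`A(φ(u_−(ζ)) ⊗ 1) = reindex epsV ((1 ζ; 0 1) ⊗ₖ 1)` (★ F5c-A `blk_matA_tensorEmbLoc` ∘ ★ B1b-2d `blocks_matA_frameConj_weylOne ∕ uMinus`).
[cite: Kudla1994, §3] [cite: HarrisKudlaSweet1996, §1 (1.11)–(1.12)] -/
theorem blkA_matA_tensorEmbLoc_frameConj_weylOne_uMinus (z : UnitaryGroup.LocalRing L v) :
    haveI : Algebra.IsQuadraticExtension (Fp L) L := IsCMField.isQuadraticExtension L
    blkA (matA (Fp L) L (IsCMField.complexConj L) v (M₂ + M₂) (tensorEmbLoc L e dV hdV dW hdW eW e' dV' hdV' v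
        (FrameTransport.frameConj (Fp L) L (IsCMField.complexConj L) v (2 + 2) (hermD_eq_map_gramD L e dV hdV dW hdW)
          (antidiagonal_over_eq_map (Fp L) L 2) Q hQ
          (toLocalFour (Fp L) L (IsCMField.complexConj L) v (weylOne (UnitaryGroup.LocalRing L v) (UnitaryGroup.conjLocal L (IsCMField.complexConj L) v)))))) =
        Matrix.reindex (epsV e eW e') (epsV e eW e') ((!![0, 1; 1, 0] : Matrix (Fin 2) (Fin 2) (LocalRing L v)) ⊗ₖ (1 : Matrix (Fin M₂) (Fin M₂) (LocalRing L v))) ∧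
      blkA (matA (Fp L) L (IsCMField.complexConj L) v (M₂ + M₂) (tensorEmbLoc L e dV hdV dW hdW eW e' dV' hdV' v
        (FrameTransport.frameConj (Fp L) L (IsCMField.complexConj L) v (2 + 2) (hermD_eq_map_gramD L e dV hdV dW hdW)
          (antidiagonal_over_eq_map (Fp L) L 2) Q hQ
          (toLocalFour (Fp L) L (IsCMField.complexConj L) v
            (uMinus (UnitaryGroup.LocalRing L v) (UnitaryGroup.conjLocal L (IsCMField.complexConj L) v)
              (UnitaryGroup.conjLocal_conjLocal (IsCMField.complexConj L) v (complexConj_imagUnit L) (imagUnit_ne_zero L)) z))))) =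
        Matrix.reindex (epsV e eW e') (epsV e eW e') ((!![1, z; 0, 1] : Matrix (Fin 2) (Fin 2) (LocalRing L v)) ⊗ₖ (1 : Matrix (Fin M₂) (Fin M₂) (LocalRing L v))) := by
  haveI : Algebra.IsQuadraticExtension (Fp L) L := IsCMField.isQuadraticExtension L
  refine ⟨?_, ?_⟩
  · rw [blkA_matA_tensorEmbLoc, (blocks_matA_frameConj_weylOne (Fp L) L (IsCMField.complexConj L) v (hermD_eq_map_gramD L e dV hdV dW hdW) D Dinv hDD Q hQm hQ).1]
  · rw [blkA_matA_tensorEmbLoc, (blocks_matA_frameConj_uMinus (Fp L) L (IsCMField.complexConj L) (complexConj_imagUnit L) (imagUnit_ne_zero L) v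
      (hermD_eq_map_gramD L e dV hdV dW hdW) D Dinv hDD Q hQm hQ z).1]

end Corners

end TensorDatum

end Summit.HodgeConjecture.HodgeConjecture.Cruxes.HLiu418.K2LiuLocalSWCornerActionWordsZeta

end
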